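import Summits.QuantumFields.YangMills.Theorems.BalabanUVNodesN11TkOpMeasurable

/-!
# DAG node N11 — MASS-BOUND CORE (generic measure theory for door (d3)): the disintegration inequality of a kernel transport in `ℝ≥0∞` WITHOUT absolute
# continuity, the two factors of one of 11a's generations in `ℝ≥0∞`, gluing of configurations on nested bond sets and the splitting of product Haar

HEADER — WORK-UNIT METADATA.  Cell `pub-ymgap`, YM-PLAN Track A (HUMAN RULING D-0062), seat `pub-ymgap-dag-n11-d` (g10; R134 fan-out seat N11 [B14], strategy s2),
route `BalabanUVNodes` rev 25, item K1⁷ `StabilityBAtRecordR13SepCoPH` = stmt-QuantumFields-20542 (helper; DEFINITION lane because of the gadget `splitGlue`;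
`--supports 20542 --as helper`, count-neutral).  [III] = [Balaban1988Convergent].  Over `T4AveragingDisintegration` (`jointLaw`, `margDensity`, `condLaw`), 11a
`Node00.TkOfRecord` (`kernelRT`, `aOp`), Mathlib's disintegration (`Measure.lintegral_condKernel`, `withDensity_rnDeriv_le`) and product-measure splitting
(`measurePreserving_piEquivPiSubtypeProd`, `measurePreserving_piCongrLeft`).

WHY THIS FILE.  The sequel `…N11TkBranchMassBound` proves that the old branches `U₀ ↦ 𝐓_k(s,S)[Φ](base_k U₀)` are `dU_k`-integrable under structural laws of the data
(door (d3) of this seat's g10 census: the last binder `hIB` of N11's off-diagonal residue).  This file holds the generic pieces, kept apart for size: (§0) for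
measurable `f ≥ 0`, `∫⁻ h(z)·∫⁻ f(z,·) dcondLaw(z) dμ ≤ ∫⁻ f(avg y, y) dν` where `h` is the marginal density — the density of the ABSOLUTELY CONTINUOUS PART of
`avg_* ν`, so no absolute continuity is needed for the inequality; (§1) the V-factor `ofReal (kernelRT g z) ≤ h z · ∫⁻ ofReal g dcondLaw z` and the ζ·A-factor
under fibre domination `ofReal (ζ·aOp w F) ≤ ∫⁻ ŵ · ofReal F`; (§2) `splitGlue` — gluing a configuration on `sVp ⊆ sV` with one on the rest — its measurability, its
identification with Mathlib's `piEquivPiSubtypeProd ∘ piCongrLeft`, the push-forward `glue_*(Haar^{sVp} ⊗ Haar^{rest}) = Haar^{sV}`, and THE GENERIC STEP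
`∫⁻ dy ∫⁻ da ŵ(a)·H(y,a) ≤ Cw·Mi` from a bound on the `sVp`-integrals uniform in the rest.

WHAT THIS FILE DEFINES ∕ PROVES (1 `def` — the gadget `splitGlue`, a plain function, not a cited notion; theorems otherwise; 0 `sorry`).
§0 `lintegral_margDensity_condLaw_le`, `ofReal_integral_le_lintegral_ofReal_of_nonneg`.  §1 `ofReal_kernelRT_le`, `ofReal_zeta_mul_aOp_le`.
§2 `splitGlue`, `splitGlue_apply_mem`, `splitGlue_apply_not_mem`, `measurable_splitGlue`, `splitGlue_eq`, `measurePreserving_splitGlue`, ★ `lintegral_lintegral_mul_le_of_split`.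

HONEST FRAMING.  Helper lane of K1⁷; measure theory only; nothing of Bałaban's is asserted.  N11 NOT discharged; K1⁷ NOT closed; counts unmoved (typed 28∕28 ·
discharged 5∕27).  One finite four-torus programme at fixed `ε = L^{−K}` — NOT ℝ⁴, NOT OS, NOT a mass gap, NOT Clay.  No `sorry`, `axiom`, `instance`, `notation`.
Sources (SHAPE only): [III] (2.21) p.258, (3.23) p.270; [Balaban1985Averaging] (10) p.19.
-/
noncomputable section

open MeasureTheory ProbabilityTheory
open scoped BigOperators ENNReal NNReal

namespace Summit.QuantumFields.YangMills.Theorems.BalabanUVNodesN11TkBranchMassBoundCore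

open Literature.MathematicalPhysics.QuantumFieldTheory.Balaban1983to89 T4Continuum T4NestedCovariance T4AdjointCovariance
open T4AveragingDisintegration (kernelTransport margDensity condLaw jointLaw measurable_margDensity jointLaw_fst measurable_graphMap)
open Node00 Node00.Tk
open BalabanUVNodesN11TkOpMeasurable (measurable_aOp measurable_tkOp measurable_genOp_genDataOfRecord measurable_baseCfg)

universe u

/-! ## §0  Generic: the disintegration inequality of a kernel transport in `ℝ≥0∞`, and `ofReal ∫ ≤ ∫⁻ ofReal` -/

section Generic

variable {α β : Type*} [MeasurableSpace α] [MeasurableSpace β] [StandardBorelSpace β] [Nonempty β]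

/-- **THE DISINTEGRATION INEQUALITY OF THE KERNEL TRANSPORT, `ℝ≥0∞` FORM, NO ABSOLUTE CONTINUITY**: for measurable `f ≥ 0`,
`∫⁻ z, h(z) · ∫⁻ y, f (z, y) ∂condLaw(z) ∂μ ≤ ∫⁻ y, f (avg y, y) ∂ν` — `h = d(avg_* ν)∕dμ` is the density of the absolutely continuous part (`withDensity_rnDeriv_le`), the
conditional kernel disintegrates the joint law (`Measure.lintegral_condKernel`), and the joint law is the graph image of `ν`. [cite: Balaban1985Averaging, (10) p.19 (bookkeeping)] -/
theorem lintegral_margDensity_condLaw_le (ν : Measure β) [IsFiniteMeasure ν] (μ : Measure α) [SigmaFinite μ] {avg : β → α}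
    (havg : Measurable avg) {f : α × β → ℝ≥0∞} (hf : Measurable f) :
    ∫⁻ z, (margDensity ν μ avg z : ℝ≥0∞) * ∫⁻ y, f (z, y) ∂(condLaw ν avg z) ∂μ ≤ ∫⁻ y, f (avg y, y) ∂ν := by
  have hg : Measurable fun z => ∫⁻ y, f (z, y) ∂(condLaw ν avg z) := hf.lintegral_kernel_prod_right'
  have h1 : ∫⁻ z, (margDensity ν μ avg z : ℝ≥0∞) * ∫⁻ y, f (z, y) ∂(condLaw ν avg z) ∂μ ≤
      ∫⁻ z, ((jointLaw ν avg).fst.rnDeriv μ z) * ∫⁻ y, f (z, y) ∂(condLaw ν avg z) ∂μ :=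
    lintegral_mono fun z => mul_le_mul' ENNReal.coe_toNNReal_le_self le_rfl
  have h2 : ∫⁻ z, ((jointLaw ν avg).fst.rnDeriv μ z) * ∫⁻ y, f (z, y) ∂(condLaw ν avg z) ∂μ =
      ∫⁻ z, ∫⁻ y, f (z, y) ∂(condLaw ν avg z) ∂(μ.withDensity ((jointLaw ν avg).fst.rnDeriv μ)) :=
    (lintegral_withDensity_eq_lintegral_mul μ (Measure.measurable_rnDeriv _ _) hg).symm
  have h3 : ∫⁻ z, ∫⁻ y, f (z, y) ∂(condLaw ν avg z) ∂(μ.withDensity ((jointLaw ν avg).fst.rnDeriv μ)) ≤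
      ∫⁻ z, ∫⁻ y, f (z, y) ∂(condLaw ν avg z) ∂(jointLaw ν avg).fst :=
    lintegral_mono' (Measure.withDensity_rnDeriv_le _ _) le_rfl
  have h4 : ∫⁻ z, ∫⁻ y, f (z, y) ∂(condLaw ν avg z) ∂(jointLaw ν avg).fst = ∫⁻ x, f x ∂(jointLaw ν avg) :=
    Measure.lintegral_condKernel hf
  have h5 : ∫⁻ x, f x ∂(jointLaw ν avg) = ∫⁻ y, f (avg y, y) ∂ν := lintegral_map hf (measurable_graphMap havg)
  calc _ ≤ _ := h1
    _ = _ := h2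
    _ ≤ _ := h3
    _ = _ := h4
    _ = _ := h5

omit [StandardBorelSpace β] [Nonempty β] in
/-- `ofReal (∫ f) ≤ ∫⁻ ofReal f` for `f ≥ 0`, WITHOUT integrability (a non-integrable `f` has Bochner integral `0`). [folklore] -/
theorem ofReal_integral_le_lintegral_ofReal_of_nonneg (μ : Measure β) {f : β → ℝ} (hf : ∀ x, 0 ≤ f x) :
    ENNReal.ofReal (∫ x, f x ∂μ) ≤ ∫⁻ x, ENNReal.ofReal (f x) ∂μ := by
  have h1 : ENNReal.ofReal (∫ x, f x ∂μ) ≤ ‖∫ x, f x ∂μ‖ₑ := by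
    rw [Real.enorm_eq_ofReal_abs]
    exact ENNReal.ofReal_le_ofReal (le_abs_self _)
  refine h1.trans ((enorm_integral_le_lintegral_enorm _).trans (lintegral_mono fun x => ?_))
  rw [Real.enorm_eq_ofReal (hf x)]

end Generic

/-! ## §1  The two factors of one generation in `ℝ≥0∞`: the V-factor's kernel transport, the ζ-weight × A-factor under fibre domination -/

section Factors

variable {P : Params} {G : Type u} {V : Type u}

/-- **THE V-FACTOR**: `ofReal (kernelRT avg g z) ≤ h(z) · ∫⁻ ofReal g ∂condLaw(z)` for `g ≥ 0`. [cite: Balaban1988Convergent, (2.21) p.258 (bookkeeping)] -/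
theorem ofReal_kernelRT_le [GaugeGroup G] [MeasurableSpace G] [HaarData G] [StandardBorelSpace G] {ι ι' : Type*} [Fintype ι] [Fintype ι']
    (avg : (ι → G) → (ι' → G)) {g : (ι → G) → ℝ} (hg : ∀ y, 0 ≤ g y) (z : ι' → G) :
    ENNReal.ofReal (kernelRT avg g z) ≤
      (margDensity (Measure.pi fun _ : ι => (HaarData.haar : Measure G)) (Measure.pi fun _ : ι' => (HaarData.haar : Measure G)) avg z : ℝ≥0∞) *
        ∫⁻ y, ENNReal.ofReal (g y) ∂(condLaw (Measure.pi fun _ : ι => (HaarData.haar : Measure G)) avg z) := by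
  rw [kernelRT_apply, ENNReal.ofReal_mul (NNReal.coe_nonneg _), ENNReal.ofReal_coe_nnreal]
  exact mul_le_mul' le_rfl (ofReal_integral_le_lintegral_ofReal_of_nonneg _ hg)

variable [NormedAddCommGroup V] [InnerProductSpace ℝ V] [FiniteDimensional ℝ V] [MeasurableSpace V] [BorelSpace V]

/-- **THE ζ-WEIGHT × A-FACTOR UNDER FIBRE DOMINATION**: if `0 ≤ ζ ω ≤ 1`, `0 ≤ w` with `ofReal (w ω′) ≤ ŵ(A_j(ω′)|sA)` for every configuration, and `F ≥ 0`, then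
`ofReal (ζ ω · (aOp w F) ω) ≤ ∫⁻ a, ŵ a · ofReal (F (ω updated by a))`. [cite: Balaban1988Convergent, (2.21) p.258, (3.23) p.270 (bookkeeping)] -/
theorem ofReal_zeta_mul_aOp_le (j : ℕ) [DecidableEq (PBond P j)] (sA : Finset (PBond P j)) {ζ w F : MultiCfg P G V → ℝ}
    (hw : ∀ ω, 0 ≤ w ω) (hF : ∀ ω, 0 ≤ F ω) (ŵ : (↥sA → V) → ℝ≥0∞)
    (hdom : ∀ ω, ENNReal.ofReal (w ω) ≤ ŵ (fun b : ↥sA => (ω j).2 b))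
    (ω : MultiCfg P G V) (hζ1 : ζ ω ≤ 1) :
    ENNReal.ofReal (ζ ω * aOp j sA w F ω) ≤
      ∫⁻ a, ŵ a * ENNReal.ofReal (F (Function.update ω j (insA sA a (ω j)))) ∂(Measure.pi fun _ : ↥sA => (volume : Measure V)) := by
  have h0 : 0 ≤ aOp j sA w F ω := aOp_nonneg j sA hw hF ω
  have h1 : ζ ω * aOp j sA w F ω ≤ aOp j sA w F ω := by
    calc ζ ω * aOp j sA w F ω ≤ 1 * aOp j sA w F ω := mul_le_mul_of_nonneg_right hζ1 h0
      _ = _ := one_mul _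
  refine (ENNReal.ofReal_le_ofReal h1).trans ?_
  rw [aOp_apply]
  refine (ofReal_integral_le_lintegral_ofReal_of_nonneg _ fun a => mul_nonneg (hw _) (hF _)).trans (lintegral_mono fun a => ?_)
  rw [ENNReal.ofReal_mul (hw _)]
  refine mul_le_mul' ?_ le_rfl
  have this := hdom (Function.update ω j (insA sA a (ω j)))
  have heq : (fun b : ↥sA => ((Function.update ω j (insA sA a (ω j))) j).2 b) = a := by
    funext b
    rw [Function.update_self]
    simp [insA, Function.updateFinset, b.2]
  rw [heq] at this
  exact this

end Factors



/-! ## §2  Generic: gluing configurations on nested bond sets; the splitting of product Haar; the generic step of the mass bound -/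

section Split

variable {ι : Type*} [DecidableEq ι] {G : Type*} [MeasurableSpace G]

/-- **GLUE** a configuration on the bonds of `sVp` and one on the remaining bonds of `sV` into a configuration on `sV` (for `sVp ⊆ sV`: the produced variables of one
generation and the other variables the next generation integrates). [cite: Balaban1988Convergent, (2.21) p.258 (bookkeeping)] -/
def splitGlue (sV sVp : Finset ι) (z : ↥sVp → G) (r : {b : ↥sV // (b : ι) ∉ sVp} → G) : ↥sV → G :=
  fun b => if h : (b : ι) ∈ sVp then z ⟨b, h⟩ else r ⟨b, h⟩

omit [MeasurableSpace G] in
/-- On `sVp` the glued configuration is the first datum. [cite: Balaban1988Convergent, (2.21) p.258 (bookkeeping)] -/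
theorem splitGlue_apply_mem (sV sVp : Finset ι) (z : ↥sVp → G) (r : {b : ↥sV // (b : ι) ∉ sVp} → G) (b : ↥sV)
    (h : (b : ι) ∈ sVp) : splitGlue sV sVp z r b = z ⟨b, h⟩ := by
  simp only [splitGlue, dif_pos h]

omit [MeasurableSpace G] in
/-- Off `sVp` the glued configuration is the second datum. [cite: Balaban1988Convergent, (2.21) p.258 (bookkeeping)] -/
theorem splitGlue_apply_not_mem (sV sVp : Finset ι) (z : ↥sVp → G) (r : {b : ↥sV // (b : ι) ∉ sVp} → G) (b : ↥sV)
    (h : (b : ι) ∉ sVp) : splitGlue sV sVp z r b = r ⟨b, h⟩ := by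
  simp only [splitGlue, dif_neg h]

/-- The glue map is jointly measurable. [cite: Balaban1988Convergent, (2.21) p.258 (bookkeeping)] -/
theorem measurable_splitGlue (sV sVp : Finset ι) :
    Measurable (fun q : (↥sVp → G) × ({b : ↥sV // (b : ι) ∉ sVp} → G) => splitGlue sV sVp q.1 q.2) := by
  refine measurable_pi_lambda _ fun b => ?_
  by_cases h : (b : ι) ∈ sVp
  · simp only [splitGlue, dif_pos h]
    exact (measurable_pi_apply _).comp measurable_fst
  · simp only [splitGlue, dif_neg h]
    exact (measurable_pi_apply _).comp measurable_snd

/-- With `sVp ⊆ sV`, the glue map IS the inverse of Mathlib's splitting of `↥sV → G` along the predicate `· ∈ sVp`, composed with the reindexing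
`{b : ↥sV // ↑b ∈ sVp} ≃ ↥sVp` on the first factor. [cite: Balaban1988Convergent, (2.21) p.258 (bookkeeping)] -/
theorem splitGlue_eq (sV sVp : Finset ι) (hsub : sVp ⊆ sV) (z : ↥sVp → G) (r : {b : ↥sV // (b : ι) ∉ sVp} → G) :
    splitGlue sV sVp z r =
      (MeasurableEquiv.piEquivPiSubtypeProd (fun _ : ↥sV => G) (fun b : ↥sV => (b : ι) ∈ sVp)).symm
        ((MeasurableEquiv.piCongrLeft (fun _ : ↥sVp => G)
          (⟨fun b => ⟨b.1.1, b.2⟩, fun b => ⟨⟨b.1, hsub b.2⟩, b.2⟩, fun _ => rfl, fun _ => rfl⟩ :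
            {b : ↥sV // (b : ι) ∈ sVp} ≃ ↥sVp)).symm z, r) := by
  funext b
  by_cases h : (b : ι) ∈ sVp
  · rw [splitGlue_apply_mem _ _ _ _ _ h]
    show z ⟨b, h⟩ = (Equiv.piEquivPiSubtypeProd (fun b : ↥sV => (b : ι) ∈ sVp) (fun _ : ↥sV => G)).symm (_, r) b
    rw [Equiv.piEquivPiSubtypeProd_symm_apply, dif_pos h]
    rfl
  · rw [splitGlue_apply_not_mem _ _ _ _ _ h]
    show r ⟨b, h⟩ = (Equiv.piEquivPiSubtypeProd (fun b : ↥sV => (b : ι) ∈ sVp) (fun _ : ↥sV => G)).symm (_, r) b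
    rw [Equiv.piEquivPiSubtypeProd_symm_apply, dif_neg h]

/-- **THE GLUE MAP PUSHES `Haar^{sVp} ⊗ Haar^{rest}` TO `Haar^{sV}`** (product probability measures; Mathlib's `measurePreserving_piEquivPiSubtypeProd` and
`measurePreserving_piCongrLeft`). [cite: Balaban1988Convergent, (2.21) p.258 (bookkeeping)] -/
theorem measurePreserving_splitGlue (μ : Measure G) [IsProbabilityMeasure μ] (sV sVp : Finset ι) (hsub : sVp ⊆ sV) :
    MeasurePreserving (fun q : (↥sVp → G) × ({b : ↥sV // (b : ι) ∉ sVp} → G) => splitGlue sV sVp q.1 q.2)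
      ((Measure.pi fun _ : ↥sVp => μ).prod (Measure.pi fun _ : {b : ↥sV // (b : ι) ∉ sVp} => μ)) (Measure.pi fun _ : ↥sV => μ) := by
  set ε : {b : ↥sV // (b : ι) ∈ sVp} ≃ ↥sVp := ⟨fun b => ⟨b.1.1, b.2⟩, fun b => ⟨⟨b.1, hsub b.2⟩, b.2⟩, fun _ => rfl, fun _ => rfl⟩ with hε
  set e := MeasurableEquiv.piEquivPiSubtypeProd (fun _ : ↥sV => G) (fun b : ↥sV => (b : ι) ∈ sVp) with he
  set E := MeasurableEquiv.piCongrLeft (fun _ : ↥sVp => G) ε with hE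
  have mpe : MeasurePreserving e (Measure.pi fun _ : ↥sV => μ)
      ((Measure.pi fun _ : {b : ↥sV // (b : ι) ∈ sVp} => μ).prod (Measure.pi fun _ : {b : ↥sV // (b : ι) ∉ sVp} => μ)) :=
    measurePreserving_piEquivPiSubtypeProd (fun _ : ↥sV => μ) _
  have mpE : MeasurePreserving E (Measure.pi fun _ : {b : ↥sV // (b : ι) ∈ sVp} => μ) (Measure.pi fun _ : ↥sVp => μ) :=
    measurePreserving_piCongrLeft (fun _ : ↥sVp => μ) ε
  have mp : MeasurePreserving (fun q : (↥sVp → G) × ({b : ↥sV // (b : ι) ∉ sVp} → G) => e.symm (E.symm q.1, q.2))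
      ((Measure.pi fun _ : ↥sVp => μ).prod (Measure.pi fun _ : {b : ↥sV // (b : ι) ∉ sVp} => μ)) (Measure.pi fun _ : ↥sV => μ) :=
    (mpe.symm e).comp ((mpE.symm E).prod (MeasurePreserving.id _))
  have hfun : (fun q : (↥sVp → G) × ({b : ↥sV // (b : ι) ∉ sVp} → G) => splitGlue sV sVp q.1 q.2) =
      fun q => e.symm (E.symm q.1, q.2) := by
    funext q
    exact splitGlue_eq sV sVp hsub q.1 q.2
  rw [hfun]
  exact mp

/-- **★ THE GENERIC STEP OF THE MASS BOUND**: Tonelli over the fibre weight `ŵ`, then the splitting `Haar^{sV} = glue_*(Haar^{sVp} ⊗ Haar^{rest})` and a bound on the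
`sVp`-integral UNIFORM in the remaining variables and the fibre variable: `∫⁻ dy ∫⁻ da ŵ(a)·H(y,a) ≤ Cw · Mi`. [cite: Balaban1988Convergent, (2.21) p.258, (3.23) p.270 (bookkeeping)] -/
theorem lintegral_lintegral_mul_le_of_split (μ : Measure G) [IsProbabilityMeasure μ] {A : Type*} [MeasurableSpace A] (μA : Measure A) [SFinite μA]
    (sV sVp : Finset ι) (hsub : sVp ⊆ sV) {H : (↥sV → G) → A → ℝ≥0∞} (hH : Measurable (Function.uncurry H)) {ŵ : A → ℝ≥0∞} (hŵ : Measurable ŵ)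
    {Cw Mi : ℝ≥0∞} (hCw : ∫⁻ a, ŵ a ∂μA ≤ Cw)
    (hIH : ∀ (r : {b : ↥sV // (b : ι) ∉ sVp} → G) (a : A), ∫⁻ z, H (splitGlue sV sVp z r) a ∂(Measure.pi fun _ : ↥sVp => μ) ≤ Mi) :
    ∫⁻ y, ∫⁻ a, ŵ a * H y a ∂μA ∂(Measure.pi fun _ : ↥sV => μ) ≤ Cw * Mi := by
  have hHa : ∀ a, Measurable (fun y => H y a) := fun a => hH.comp (measurable_id.prodMk measurable_const)
  have hF : Measurable (Function.uncurry fun (y : ↥sV → G) (a : A) => ŵ a * H y a) := (hŵ.comp measurable_snd).mul hH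
  have hinner : ∀ a, ∫⁻ y, H y a ∂(Measure.pi fun _ : ↥sV => μ) ≤ Mi := by
    intro a
    have hm : Measurable (fun q : (↥sVp → G) × ({b : ↥sV // (b : ι) ∉ sVp} → G) => H (splitGlue sV sVp q.1 q.2) a) :=
      (hHa a).comp (measurable_splitGlue sV sVp)
    rw [← (measurePreserving_splitGlue μ sV sVp hsub).lintegral_comp (hHa a)]
    calc ∫⁻ q, H (splitGlue sV sVp q.1 q.2) a ∂((Measure.pi fun _ : ↥sVp => μ).prod (Measure.pi fun _ : {b : ↥sV // (b : ι) ∉ sVp} => μ))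
        = ∫⁻ r, ∫⁻ z, H (splitGlue sV sVp z r) a ∂(Measure.pi fun _ : ↥sVp => μ) ∂(Measure.pi fun _ : {b : ↥sV // (b : ι) ∉ sVp} => μ) :=
          lintegral_prod_symm _ hm.aemeasurable
      _ ≤ ∫⁻ _r, Mi ∂(Measure.pi fun _ : {b : ↥sV // (b : ι) ∉ sVp} => μ) := lintegral_mono fun r => hIH r a
      _ = Mi := by rw [lintegral_const, measure_univ, mul_one]
  calc ∫⁻ y, ∫⁻ a, ŵ a * H y a ∂μA ∂(Measure.pi fun _ : ↥sV => μ)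
      = ∫⁻ a, ∫⁻ y, ŵ a * H y a ∂(Measure.pi fun _ : ↥sV => μ) ∂μA := lintegral_lintegral_swap hF.aemeasurable
    _ = ∫⁻ a, ŵ a * ∫⁻ y, H y a ∂(Measure.pi fun _ : ↥sV => μ) ∂μA := lintegral_congr fun a => lintegral_const_mul _ (hHa a)
    _ ≤ ∫⁻ a, ŵ a * Mi ∂μA := lintegral_mono fun a => mul_le_mul' le_rfl (hinner a)
    _ = (∫⁻ a, ŵ a ∂μA) * Mi := lintegral_mul_const _ hŵ
    _ ≤ Cw * Mi := mul_le_mul' hCw le_rfl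


end Split

end Summit.QuantumFields.YangMills.Theorems.BalabanUVNodesN11TkBranchMassBoundCore

end
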